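import Mathlib
import HarnessLib
import Summits.ResolutionOfSingularities.ResolutionOfSingularities.Theorems.WildQuotientsWildQuotientResolutionS1aCentreGluing
import Summits.ResolutionOfSingularities.ResolutionOfSingularities.Theorems.WildQuotientsWildQuotientResolutionS1aAuxTop

/-!
# S1a — THE KILL HALF FROM A DISJOINTLY-SUPPORTED FAMILY OF PRINCIPAL CENTRES ((K2) gluing in geometric form)

[OURS · L1 W4.5c · lead-1 g8; plan-1 g12 STRATEGY-DESIGN v3.2 §1 (K1)/(K2)/(K3) anatomy, v3.5 §4 row (2) «F5 (K2) gluing … written so that the disjoint-support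
case (A2-glue) is the same lemma»] — NOT statements of the manuscript; counted 0; AI-level work, weaker than expert review. Crux
stmt-ResolutionOfSingularities-17941, line `s1a-logminvertex` v6, stub `stub_winningStrategy`. Route-independent.

The user-facing form of `CentreGluing.isPrincipalCentre_infRees` (p612813): finitely many PRINCIPAL CENTRES `𝒦ᵢ` of one Veronese degree `d` on a model,
with PAIRWISE DISJOINT supports `supp (𝒦ᵢ.ideal d)`, glue (by intersection `⨅ᵢ 𝒦ᵢ`) to ONE principal centre whose principal-centre charts contain every BAD
point of every `principalKillOpen 𝒦ᵢ d` — so a family whose kill-opens cover the bad locus gives the KILL HALF in cover form at that model.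
* support bookkeeping: `ideal_eq_top_of_disjoint_support`, `pow_ideal_le`, `support_subset_support` (`supp 𝒦ₙ ⊆ supp 𝒦_d` for `0 < d`),
  `filtration_eq_top_of_disjoint`, `exists_stable_open_off` (the complement of finitely many `G`-stable supports is a `G`-stable open);
* `exists_chart_at_support` (at a point of `supp 𝒦_{i₀}`: a principal chart of `𝒦_{i₀}` on which every other `𝒦ⱼ` is trivial — `exists_isPrincipalCentreChart_le`,
  p610717), `exists_chart_off_support` (off all supports: a node chart on which every `𝒦ⱼ` is trivial — `exists_isNodeChart_le`, p608356);
* ★ `isPrincipalCentre_infRees_of_disjoint`, ★ `badLocus_inter_subset_principalKillOpen_infRees` (uses G1 = `g1`, p612119: a bad point of a principal chart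
  lies in the support), ★ `exists_killCover_of_family`;
* `KillFamilyReach p` (research def, OURS CANDIDATE: at a reachable non-terminal `jInf = ⊥` model such a family exists — the K side reduced to PER-COMPONENT
  canonical kills with disjoint supports, (K1)+(K3) content) and `killHalfCoverReach_of_killFamilyReach`.
-/

set_option linter.dupNamespace false

noncomputable section

universe u

open CategoryTheory Limits AlgebraicGeometry TopologicalSpace Topology
open Literature.AlgebraicGeometry.Resolution Literature.AlgebraicGeometry.RelativeSpec
open Summit.ResolutionOfSingularities.ResolutionOfSingularities.Theorems.WildQuotientResolution.S1
open Summit.ResolutionOfSingularities.ResolutionOfSingularities.Theorems.WildQuotientResolution.S1.NodeAtlas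
open Summit.ResolutionOfSingularities.ResolutionOfSingularities.Theorems.WildQuotientResolution.S1.BlowupCharts
open Summit.ResolutionOfSingularities.ResolutionOfSingularities.Theorems.WildQuotientResolution.S1.CentreGluing
open Summit.ResolutionOfSingularities.ResolutionOfSingularities.Theorems.WildQuotientResolution.S1.PrincipalChartShrink
open Summit.ResolutionOfSingularities.ResolutionOfSingularities.Theorems.WildQuotientResolution.S1.NodeChartAway
open Summit.ResolutionOfSingularities.ResolutionOfSingularities.Theorems.WildQuotientResolution.S1.KillableTransport
open Summit.ResolutionOfSingularities.ResolutionOfSingularities.Theorems.WildQuotientResolution.S1.G1Proof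

namespace Summit.ResolutionOfSingularities.ResolutionOfSingularities.Theorems.WildQuotientResolution.S1.KillFamily

/-! ## Support bookkeeping for Rees filtrations -/

section Support

variable {V : Scheme.{u}}

/-- An affine open DISJOINT from the support of an ideal sheaf carries the unit ideal. -/
theorem ideal_eq_top_of_disjoint_support (I : V.IdealSheafData) (U : V.affineOpens) (h : Disjoint (U.1 : Set V) I.support) :
    I.ideal U = ⊤ := by
  have h1 : V.zeroLocus (U := U.1) (I.ideal U : Set Γ(V, U.1)) ∩ U.1 = ∅ := by
    rw [← Scheme.IdealSheafData.coe_support_inter]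
    exact Set.disjoint_iff_inter_eq_empty.mp h.symm
  have h2 := U.2.fromSpec_image_zeroLocus (I.ideal U : Set Γ(V, U.1))
  rw [h1, Set.image_eq_empty] at h2
  exact PrimeSpectrum.zeroLocus_empty_iff_eq_top.mp h2

/-- Multiplication of ideal sheaves is monotone. -/
theorem mul_mono {I I' J J' : V.IdealSheafData} (h₁ : I ≤ I') (h₂ : J ≤ J') : I * J ≤ I' * J' := by
  rw [Scheme.IdealSheafData.le_def] at h₁ h₂ ⊢
  intro U
  rw [Scheme.IdealSheafData.ideal_mul, Scheme.IdealSheafData.ideal_mul, Pi.mul_apply, Pi.mul_apply]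
  exact Ideal.mul_mono (h₁ U) (h₂ U)

/-- Powers of a piece lie in the later pieces: `𝒦_d ^ n ≤ 𝒦_{n d}`. -/
theorem pow_ideal_le (𝒦 : ReesFiltration V) (d n : ℕ) : (𝒦.ideal d) ^ n ≤ 𝒦.ideal (n * d) := by
  induction n with
  | zero => rw [pow_zero, Nat.zero_mul, 𝒦.ideal_zero, Scheme.IdealSheafData.one_eq_top]
  | succ n ih =>
    rw [pow_succ, Nat.succ_mul]
    exact (mul_mono ih le_rfl).trans (𝒦.mul_le (n * d) d)

/-- **All pieces of a Rees filtration are supported inside `supp 𝒦_d`** (`0 < d`): `𝒦_{nd} ≤ 𝒦ₙ` and `𝒦_d ^ n ≤ 𝒦_{nd}`. -/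
theorem support_subset_support (𝒦 : ReesFiltration V) {d : ℕ} (hd : 0 < d) (n : ℕ) :
    ((𝒦.ideal n).support : Set V) ⊆ (𝒦.ideal d).support := by
  rcases Nat.eq_zero_or_pos n with rfl | hn
  · rw [𝒦.ideal_zero, Scheme.IdealSheafData.support_top]
    exact fun x hx => absurd hx (Set.notMem_empty x)
  · have h3 : (𝒦.ideal n).support ≤ (𝒦.ideal (n * d)).support :=
      Scheme.IdealSheafData.support_antitone (𝒦.antitone (Nat.le_mul_of_pos_right n hd))
    have h4 : (𝒦.ideal (n * d)).support ≤ ((𝒦.ideal d) ^ n).support :=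
      Scheme.IdealSheafData.support_antitone (pow_ideal_le 𝒦 d n)
    rw [Scheme.IdealSheafData.support_pow _ n hn.ne'] at h4
    exact fun x hx => h4 (h3 hx)

/-- **An affine open disjoint from `supp 𝒦_d` carries the UNIT filtration.** -/
theorem filtration_eq_top_of_disjoint (𝒦 : ReesFiltration V) {d : ℕ} (hd : 0 < d) (U : V.affineOpens)
    (h : Disjoint (U.1 : Set V) (𝒦.ideal d).support) (n : ℕ) : (𝒦.filtration U).ideal n = ⊤ := by
  rw [ReesFiltration.filtration_ideal]
  exact ideal_eq_top_of_disjoint_support _ U (h.mono_right (support_subset_support 𝒦 hd n))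

end Support

/-! ## The charts of the intersection of a disjointly-supported family -/

section Family

variable {p : ℕ} {X' X₁ : Scheme.{0}} {q : X' ⟶ X₁} {G : Type} [Group G] {ρ : G →* Aut X'} {g₀ : G} {ι : Type} [Finite ι]

/-- The complement of the supports `supp 𝒦ⱼ_d`, `j ∈ S`, of `G`-stable pieces is a `G`-STABLE OPEN. -/
theorem exists_stable_open_off (M : GameFrame.GModel p q G ρ g₀) (𝒦 : ι → ReesFiltration M.V) (d : ℕ)
    (hGst : ∀ (i : ι) (g : G), ((𝒦 i).ideal d).comap (M.act.aut g).hom = (𝒦 i).ideal d) (S : Set ι) :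
    ∃ U : M.V.Opens, (∀ x : M.V, x ∈ U ↔ ∀ j ∈ S, x ∉ (((𝒦 j).ideal d).support : Set M.V)) ∧
      ∀ g : G, (M.act.aut g).hom ⁻¹ᵁ U = U := by
  refine ⟨⟨⋂ j ∈ S, (((𝒦 j).ideal d).support : Set M.V)ᶜ,
    S.toFinite.isOpen_biInter fun j _ => ((𝒦 j).ideal d).support.isClosed.isOpen_compl⟩, fun x => Set.mem_iInter₂, fun g => ?_⟩
  ext x
  change (M.act.aut g).hom.base x ∈ (⋂ j ∈ S, (((𝒦 j).ideal d).support : Set M.V)ᶜ) ↔ x ∈ ⋂ j ∈ S, (((𝒦 j).ideal d).support : Set M.V)ᶜ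
  simp only [Set.mem_iInter, Set.mem_compl_iff]
  refine forall₂_congr fun j _ => not_congr ?_
  have h := congrArg (fun J : M.V.IdealSheafData => ((J.support : Set M.V))) (hGst j g)
  simp only [Scheme.IdealSheafData.support_comap, TopologicalSpace.Closeds.coe_preimage] at h
  exact Set.ext_iff.mp h x

/-- **AT A POINT OF `supp 𝒦_{i₀}`**: a principal-centre chart of `𝒦_{i₀}` through `v`, inside any given `G`-stable open, on which every OTHER member of a
disjointly-supported family of principal centres is TRIVIAL. [OURS · L1 W4.5c] -/
theorem exists_chart_at_support [Finite G] (M : GameFrame.GModel p q G ρ g₀) (𝒦 : ι → ReesFiltration M.V) {d : ℕ} (hd : 0 < d)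
    (hprin : ∀ i, IsPrincipalCentre p M.act g₀ (𝒦 i) d)
    (hdisj : Pairwise fun i j => Disjoint (((𝒦 i).ideal d).support : Set M.V) ((𝒦 j).ideal d).support)
    {i₀ : ι} {v : M.V} (hvs : v ∈ ((𝒦 i₀).ideal d).support) {U₀ : M.V.Opens} (hU₀ : ∀ g : G, (M.act.aut g).hom ⁻¹ᵁ U₀ = U₀) (hvU₀ : v ∈ U₀) :
    ∃ O : M.act.StableAffineOpens, v ∈ O.1 ∧ O.1 ≤ U₀ ∧ IsPrincipalCentreChart p M.act g₀ (𝒦 i₀) d O ∧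
      ∀ (hO : IsAffineOpen O.1) (j : ι), (∀ n, ((𝒦 j).filtration ⟨O.1, hO⟩).ideal n = ⊤) ∨
        ∀ n, ((𝒦 j).filtration ⟨O.1, hO⟩).ideal n = ((𝒦 i₀).filtration ⟨O.1, hO⟩).ideal n := by
  -- the chart of `𝒦 i₀` at `v` is principal: an idle chart misses the support
  obtain ⟨O, hvO, hO | hO⟩ := (hprin i₀).2.2 v
  swap
  · exact absurd hvs (Set.disjoint_left.mp
      (disjoint_support_of_ideal_eq_top hO.1.1 (by rw [← ReesFiltration.filtration_ideal]; exact hO.2 d)) hvO)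
  -- shrink into `U₀ ∩ (off the other supports)`
  obtain ⟨U, hUmem, hUG⟩ := exists_stable_open_off M 𝒦 d (fun i g => (hprin i).2.1 g d) {j | j ≠ i₀}
  have hvU : v ∈ U := (hUmem v).mpr fun j hj hvj => Set.disjoint_left.mp (hdisj hj) hvj hvs
  obtain ⟨O'', hvO'', -, hO''U, -, hO''⟩ := exists_isPrincipalCentreChart_le hO hvO hvs (U ⊓ U₀)
    (fun g => by change (M.act.aut g).hom ⁻¹ᵁ U ⊓ (M.act.aut g).hom ⁻¹ᵁ U₀ = U ⊓ U₀; rw [hUG g, hU₀ g]) ⟨hvU, hvU₀⟩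
  refine ⟨O'', hvO'', fun x hx => (hO''U hx).2, hO'', fun hOa j => ?_⟩
  by_cases hj : j = i₀
  · subst hj
    exact Or.inr fun n => rfl
  · refine Or.inl (filtration_eq_top_of_disjoint (𝒦 j) hd ⟨O''.1, hOa⟩ ?_)
    rw [Set.disjoint_left]
    intro x hx hxj
    exact (hUmem x).mp (hO''U hx).1 j hj hxj

/-- **OFF ALL SUPPORTS**: a node chart through `v` on which every member is TRIVIAL. [OURS · L1 W4.5c] -/
theorem exists_chart_off_support [Finite G] (M : GameFrame.GModel p q G ρ g₀) (𝒦 : ι → ReesFiltration M.V) {d : ℕ} (hd : 0 < d)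
    (hGst : ∀ (i : ι) (g : G), ((𝒦 i).ideal d).comap (M.act.aut g).hom = (𝒦 i).ideal d)
    {v : M.V} (hv : ∀ i, v ∉ (((𝒦 i).ideal d).support : Set M.V)) :
    ∃ O : M.act.StableAffineOpens, v ∈ O.1 ∧ ∃ hn : IsNodeChart p M.act g₀ O, ∀ (j : ι) (n : ℕ), ((𝒦 j).filtration ⟨O.1, hn.1⟩).ideal n = ⊤ := by
  obtain ⟨O, hvO, hn⟩ := M.atlas v
  obtain ⟨U, hUmem, hUG⟩ := exists_stable_open_off M 𝒦 d hGst Set.univ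
  have hvU : v ∈ U := (hUmem v).mpr fun j _ => hv j
  obtain ⟨O'', hvO'', -, hO''U, hn''⟩ := exists_isNodeChart_le hn hvO U hUG hvU
  refine ⟨O'', hvO'', hn'', fun j n => filtration_eq_top_of_disjoint (𝒦 j) hd ⟨O''.1, hn''.1⟩ ?_ n⟩
  rw [Set.disjoint_left]
  intro x hx hxj
  exact (hUmem x).mp (hO''U hx) j (Set.mem_univ j) hxj

/-- ★ **A DISJOINTLY-SUPPORTED FINITE FAMILY OF PRINCIPAL CENTRES GLUES TO ONE PRINCIPAL CENTRE** `⨅ᵢ 𝒦ᵢ` (same Veronese degree `d`).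
[OURS · L1 W4.5c] -/
theorem isPrincipalCentre_infRees_of_disjoint [Finite G] (M : GameFrame.GModel p q G ρ g₀) (𝒦 : ι → ReesFiltration M.V) {d : ℕ} (hd : 0 < d)
    (hprin : ∀ i, IsPrincipalCentre p M.act g₀ (𝒦 i) d)
    (hdisj : Pairwise fun i j => Disjoint (((𝒦 i).ideal d).support : Set M.V) ((𝒦 j).ideal d).support) :
    IsPrincipalCentre p M.act g₀ (infRees 𝒦) d := by
  have hGst : ∀ (i : ι) (g : G) (n : ℕ), ((𝒦 i).ideal n).comap (M.act.aut g).hom = (𝒦 i).ideal n := fun i g n => (hprin i).2.1 g n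
  refine isPrincipalCentre_infRees (ρ := M.act) (g₀ := g₀) 𝒦 hd hGst fun v => ?_
  by_cases h : ∃ i₀, v ∈ (((𝒦 i₀).ideal d).support : Set M.V)
  · obtain ⟨i₀, hvs⟩ := h
    obtain ⟨O, hvO, -, hO, hj⟩ := exists_chart_at_support M 𝒦 hd hprin hdisj hvs (U₀ := ⊤) (fun g => Opens.map_top _) trivial
    exact ⟨O, hvO, Or.inl ⟨i₀, hO, hj⟩⟩
  · have h' : ∀ i, v ∉ (((𝒦 i).ideal d).support : Set M.V) := fun i hi => h ⟨i, hi⟩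
    obtain ⟨O, hvO, hn, hj⟩ := exists_chart_off_support M 𝒦 hd (fun i g => hGst i g d) h'
    exact ⟨O, hvO, Or.inr ⟨hn, hj⟩⟩

/-- ★ **EVERY BAD POINT OF A KILL-OPEN OF A MEMBER LIES IN A PRINCIPAL-CENTRE CHART OF THE GLUED CENTRE** (G1: a bad point of a principal chart lies
in the support; then shrink off the other supports). [OURS · L1 W4.5c] -/
theorem badLocus_inter_subset_principalKillOpen_infRees [Finite G] (hp : p.Prime) (hG : ∀ g : G, g ∈ Subgroup.zpowers g₀)
    (M : GameFrame.GModel p q G ρ g₀) (hB : M.HasNoetherianBase) (𝒦 : ι → ReesFiltration M.V) {d : ℕ} (hd : 0 < d)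
    (hprin : ∀ i, IsPrincipalCentre p M.act g₀ (𝒦 i) d)
    (hdisj : Pairwise fun i j => Disjoint (((𝒦 i).ideal d).support : Set M.V) ((𝒦 j).ideal d).support) (i₀ : ι) :
    M.badLocus ∩ M.principalKillOpen (𝒦 i₀) d ⊆ M.principalKillOpen (infRees 𝒦) d := by
  rintro v ⟨hv, hvi⟩
  obtain ⟨O, hvO'⟩ := Set.mem_iUnion.mp hvi
  obtain ⟨hO, hvO⟩ := Set.mem_iUnion.mp hvO'
  have hvs : v ∈ (((𝒦 i₀).ideal d).support : Set M.V) := g1 hp q G ρ g₀ hG M (𝒦 i₀) d O hB hO v hvO hv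
  obtain ⟨O'', hvO'', -, hO'', hj⟩ := exists_chart_at_support M 𝒦 hd hprin hdisj hvs (U₀ := ⊤) (fun g => Opens.map_top _) trivial
  exact Set.mem_iUnion.mpr ⟨O'', Set.mem_iUnion.mpr ⟨isPrincipalCentreChart_infRees (ρ := M.act) (g₀ := g₀) 𝒦 i₀ hO'' hj, hvO''⟩⟩

/-- ★ **THE KILL HALF (cover form) AT A MODEL FROM A DISJOINTLY-SUPPORTED FAMILY WHOSE KILL-OPENS COVER THE BAD LOCUS.** [OURS · L1 W4.5c] -/
theorem exists_killCover_of_family [Finite G] (hp : p.Prime) (hG : ∀ g : G, g ∈ Subgroup.zpowers g₀)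
    (M : GameFrame.GModel p q G ρ g₀) (hB : M.HasNoetherianBase) (𝒦 : ι → ReesFiltration M.V) {d : ℕ} (hd : 0 < d)
    (hprin : ∀ i, IsPrincipalCentre p M.act g₀ (𝒦 i) d)
    (hdisj : Pairwise fun i j => Disjoint (((𝒦 i).ideal d).support : Set M.V) ((𝒦 j).ideal d).support)
    (hcov : M.badLocus ⊆ ⋃ i, M.principalKillOpen (𝒦 i) d) :
    ∃ (𝒦' : ReesFiltration M.V) (d' : ℕ), IsPrincipalCentre p M.act g₀ 𝒦' d' ∧ M.badLocus ⊆ M.principalKillOpen 𝒦' d' := by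
  refine ⟨infRees 𝒦, d, isPrincipalCentre_infRees_of_disjoint M 𝒦 hd hprin hdisj, fun v hv => ?_⟩
  obtain ⟨i₀, hvi⟩ := Set.mem_iUnion.mp (hcov hv)
  exact badLocus_inter_subset_principalKillOpen_infRees hp hG M hB 𝒦 hd hprin hdisj i₀ ⟨hv, hvi⟩

end Family

/-! ## The K side reduced to per-component kills with disjoint supports (research def) -/

/-- **`KillFamilyReach p`** (OURS CANDIDATE research statement, asserted nowhere; the K-side residual in FAMILY form): at every non-terminal model
reachable from the initial model of a crux datum with all bad points killable (`jInf = ⊥`) there are finitely many PRINCIPAL CENTRES of one Veronese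
degree with PAIRWISE DISJOINT supports whose kill-opens cover the bad locus. Content = (K1) canonicity of the LP-minimal local kill (so the local kill
filtrations along ONE bad component glue to a principal centre supported on it) + (K3) support = the bad component (F-SUP 74/74, THETA-LP-CENSUS v3) +
pairwise disjointness of the bad components met this way; evidence dim 4 only. By `exists_killCover_of_family` it implies the cover form
`KillHalfCoverReach`. [OURS · L1 W4.5c] -/
def KillFamilyReach (p : ℕ) : Prop :=
  ∀ (k : Type) [Field k] [CharP k p] [PerfectField k] (X' X₁ : Scheme.{0})
    (f : X₁ ⟶ Spec (.of k)) (q : X' ⟶ X₁) (G : Type) [Group G] [Finite G]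
    (ρ : G →* Aut X'), Nat.card G = p → IsSeparated f → LocallyOfFiniteType f → QuasiCompact f →
    IsIntegral X₁ → ∀ [IsIntegral X'], Scheme.IsRegular X' → IsFinite q → Function.Surjective q.base →
    (∃ U : X₁.Opens, Dense (U : Set X₁) ∧ Etale (q ∣_ U)) →
    ∀ (hq : ∀ g : G, (ρ g).hom ≫ q = q),
    (∀ x y : X', q.base x = q.base y → ∃ g : G, (ρ g).hom.base x = y) →
    topologicalKrullDim X₁ ≤ 4 → Function.Injective ρ →
    ∀ (g₀ : G), (∀ g : G, g ∈ Subgroup.zpowers g₀) → ∀ [IsLocallyNoetherian X']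
      (h₀ : NodeAtlas p (⟨ρ, hq⟩ : ActionOver q G) g₀),
      ∀ M : GameFrame.GModel p q G ρ g₀, (GameFrame.GModel.initial hq h₀).Reachable M → ¬ M.Terminal → M.jInf = ⊥ →
        ∃ (n : ℕ) (𝒦 : Fin n → ReesFiltration M.V) (d : ℕ), 0 < d ∧ (∀ i, IsPrincipalCentre p M.act g₀ (𝒦 i) d) ∧
          (Pairwise fun i j => Disjoint (((𝒦 i).ideal d).support : Set M.V) ((𝒦 j).ideal d).support) ∧
          M.badLocus ⊆ ⋃ i, M.principalKillOpen (𝒦 i) d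

/-- **Family form ⇒ cover form**: `KillFamilyReach p ⇒ KillHalfCoverReach p`. [OURS · L1 W4.5c] -/
theorem killHalfCoverReach_of_killFamilyReach {p : ℕ} (hp : p.Prime) (h : KillFamilyReach p) : KillHalfCoverReach p := by
  intro k _ _ _ X' X₁ f q G _ _ ρ hG hfs hfft hfqc hX₁ _ hreg hqfin hqs hqet hq horb hdim hinj g₀ hg₀ _ h₀ M hR hT hj
  haveI := hfft
  haveI := hfqc
  obtain ⟨n, 𝒦, d, hd, hprin, hdisj, hcov⟩ :=
    h k X' X₁ f q G ρ hG hfs hfft hfqc hX₁ hreg hqfin hqs hqet hq horb hdim hinj g₀ hg₀ h₀ M hR hT hj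
  exact exists_killCover_of_family hp hg₀ M (GameFrame.GModel.hasNoetherianBase_of_datum f M) 𝒦 hd hprin hdisj hcov

/-- **The residual after both cuts**: `KillFamilyReach p ∧ AuxTopReach p ⇒ KillOrAuxRuleJInfReach p`. [OURS · L1 W4.5c] -/
theorem killOrAuxRuleJInfReach_of_killFamilyReach_of_auxTopReach {p : ℕ} (hp : p.Prime) (hK : KillFamilyReach p) (hA : AuxTopReach p) :
    KillOrAuxRuleJInfReach p :=
  killOrAuxRuleJInfReach_of_killHalfCoverReach_of_auxTopReach hp (killHalfCoverReach_of_killFamilyReach hp hK) hA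

end Summit.ResolutionOfSingularities.ResolutionOfSingularities.Theorems.WildQuotientResolution.S1.KillFamily

end
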